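import Literature.AlgebraicGeometry.HodgeTheory.CupPreservesHodgeTypeOfDeRham
import Literature.NumberTheory.Transcendental.DeRhamTheoremMultiplicative
import Literature.Geometry.Kaehler.SmoothHermitianBundleChernCharacter
import HarnessLib

/-!
# Chern-normalised Hodge models: the comparison IS de Rham's integration isomorphism

Family `hodge`, layer `Literature/AlgebraicGeometry/HodgeTheory`. Definition requested by route
`HodgeConjecture/HolomorphicityRate` (crux `RateGap`, item `stmt-HodgeConjecture-10762`; also the
robustness defect recorded on route `HolomorphicDefect`, `stmt-HodgeConjecture-3029 → 17583`).

## The defect being repaired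

A `HodgeModel n X` (`RationalHodgeClasses`) carries an ARBITRARY complex de Rham comparison family
`A.deRham : H^k_dR(–; ℂ) ≃ₗ[ℂ] Hᵏ(–; ℂ)` over the manifolds charted on `A.model`, constrained only
to be NATURAL. Rescaling a natural family degree-wise by `t_k ∈ ℂˣ` keeps it natural and keeps
`A.pullback`, `A.hodgePQ`, so every EQUALITY between a Chern–Weil class read through `A.deRham`
(`SmoothHermitianBundle.chernCharacter F A.deRham p`, a Kähler class `A.deRham[ω]`, a Chern form class
`A.deRham[ω_{L,h}]`) and a canonical Betti class (`A.pullback k c`, a hyperplane class, an integral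
class) is model-dependent — whence the scalar `μ` in the tree's Lefschetz-`(1,1)` heart
(`β = μ • A.deRham[θ]`, `LefschetzOneOneChernWeil*`), the freedom `chᵢ ↦ λⁱ chᵢ` of
`ChernCharacterBetti` (`ChernCharacterBettiRescale`), and the falsity, for rescaled models, of
statements NAMING the class carried by a zero locus (`(−1)^{p−1}(p−1)! ch_p(E) + kᵖ hᵖ`).

## The normalisation

In print there is ONE comparison: de Rham's isomorphism `[ω] ↦ (φ ↦ ∫_{Δ_q} φ^* ω)` by integration
of closed forms over (smooth) singular simplices (Voisin I, §4.3.2 Thm. 4.47 with Rem. 4.48, PDF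
p. 99: "the map `ω ↦ ∫ω` … necessarily induces the above isomorphism `H^q_DR(X) ≅ H^q_sing(X, ℝ)`";
Warner 5.35–5.36 / Thm. 5.45; Bott–Tu §I.5, Thm. 8.9, Thm. 15.8), and every printed normalisation
identity refers to it: "the class of the Chern form `ω_{L,h}` is equal to the image of `c₁(L)` in
`H²(X, ℝ)`" (Voisin I Thm. 7.10, via an INTEGRAL Čech cocycle, PDF p. 136); "`H = c₁(𝒪_S(1))` (it
is the Kähler class of the restriction of the Fubini–Study metric)" (Voisin I §7.2.3, PDF p. 146);
"the `k`-th Chern class `c_k(E)` … is represented by the closed `2k`-form `γ_k`" built from the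
curvature, with "`c₁(L)` evaluated (or integrated) on the fundamental `2`-cycle `P₁ℂ` … equal to
`−1`" for the tautological `L` (Kobayashi II Axiom 4, Thm. 2.16, (2.20)–(2.21) for `ch`, PDF
pp. 27–35: "via the de Rham theory"). The tree HAS this comparison:
`integrationDeRhamIsoFamily E` (`Transcendental/DeRhamTheoremProofs`, `[α] ↦ [σ ↦ ∫_σ α]`, Bredon
Thm. V.9.5 / Lee Thm. 18.14), PROVED natural, normalised (`[1] ↦ 1`) and multiplicative
(`integrationDeRhamIsoFamily_isMultiplicative`, Warner Thm. 5.45), with its complexification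
`e ⊗ ℂ` (`DeRhamIsoFamily.complexify`, `ComplexifiedDeRhamFamily`: natural, real). Hence:

* `HodgeModel.IsChernNormalised A` — **`A.deRham = (integrationDeRhamIsoFamily A.model) ⊗ ℂ`**, an
  equality of families (every manifold charted on `A.model`, every degree; `isChernNormalised_iff`).
  It pins all scalars `t_k` at once to the values for which the printed identities hold; the
  consequences are THEOREMS about the one family: (a) **multiplicative and unital** —
  `IsChernNormalised.deRham_mk_wedge` (`A.deRham[α ∧ β] = A.deRham[α] ⌣ A.deRham[β]`, the
  hypothesis shape `hmul` of `ComplexGysinHodgeTypeModels`), `IsChernNormalised.deRham_one`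
  (`A.deRham[1] = 1`), `IsChernNormalised.chernCharacter_zero` (**`ch₀(F) = rank F · 1`**, Kobayashi
  II (1.10)), `IsChernNormalised.cupProduct_mem_hodgePQ` / `…pullback_cupProduct_mem_hodgePQ` (cup
  products ADD Hodge types inside the fixed model `A`, Voisin I Thm. 5.29 with §7.1.2 — no
  `hodgePQ_independent_of_hodgeModel`); (b) **real** — `IsChernNormalised.isReal` (Voisin I
  Cor. 6.12), hence Hodge symmetric; (c) **normalised in degree `2`** — Lefschetz `(1,1)` in
  Chern–Weil form WITHOUT scalar (`ComplexDeRhamIsoFamily.IsLefschetzOneOne`, Voisin I Thm. 11.30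
  with Thm. 7.10 (i): `isLefschetzOneOne_complexify_integration_of_cechIntegral` +
  `CechCocycleIntegral_holds`), drawn in the companion `HodgeModelChernNormalisedHolds` (heavier
  import cone).
* `HodgeModel.chernNormalise A` — **the normalisation** (same analytification and Hodge
  decomposition, comparison replaced by `integration ⊗ ℂ`), so that the companion existence
  statement asked for by the route is a THEOREM: `exists_isChernNormalised_of_nonempty`,
  `exists_isChernNormalised` (from the named fact `nonempty_hodgeModel n X`, discharged as
  `nonempty_hodgeModel_holds`; fully discharged form `exists_isChernNormalised_holds` in the
  companion file).

## Design and faithfulness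

* Why an equality with the canonical family, not "multiplicative ∧ unital ∧ `c₁`-normalised":
  multiplicativity and unitality pin `t_{k+l} = t_k t_l`, `t₀ = 1` only (`t₁ ∈ ℂˣ` stays free); a
  degree-`2` clause against a Betti `c₁` would need a topological first Chern class whose SIGN the
  tree does not fix (its Thom/Euler classes and reference generators are `Classical.choice`s —
  docstrings of `CharacteristicClasses/TopologicalChernClasses`, `Manifold/DeRhamFundamentalClassPairing`),
  or a hyperplane class, which in the tree is a datum of the hypothesis structure
  `HardLefschetzNFold`. The integration family is canonical, parameter- and sign-free (`∫_σ α`),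
  exists today with the three printed properties PROVED, and is the family about which every
  normalisation theorem of the tree is stated — the strongest and the only presently inhabited
  rendering.
* It says nothing about `A.carrier` / `A.toComplexPoints` (any analytification: two differ by a
  unique biholomorphism, `IsAnalytification.unique`). Hodge TYPES read in `A` and `A.chernNormalise`
  agree by rigidity (`hodgePQ_independent_of_hodgeModel`), not used here.
* No named fact (D-0026): one definition, one construction, theorems.

## References

* [VoisinHodgeI2002] C. Voisin, *Hodge Theory and Complex Algebraic Geometry I* (CUP 2002), §4.3.2
  Thm. 4.47, Rem. 4.48; §5.3.2 Thm. 5.29; §6.1.3 Cor. 6.12; §7.1.2; Thm. 7.10; §7.2.3; Thm. 11.30.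
* [Kobayashi1987] S. Kobayashi, *Differential Geometry of Complex Vector Bundles* (1987), Ch. II §1
  Axioms 1–4, (1.10); §2 Thm. 2.16, (2.20)–(2.21).
* [WarnerGTM94] F. W. Warner, *Foundations of Differentiable Manifolds and Lie Groups* (1983),
  5.35–5.36, Thm. 5.45.
* [BottTu1982Forms] R. Bott, L. W. Tu, *Differential Forms in Algebraic Topology* (1982), §I.5,
  Thm. 8.9, Thm. 15.8.  * [Bredon1993] G. E. Bredon, *Topology and Geometry* (1993), Thm. V.9.5.
* [LeeSmoothManifolds2013] J. M. Lee, *Introduction to Smooth Manifolds*, 2nd ed. (2013), Thm. 18.14.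
-/

noncomputable section

open scoped Manifold ContDiff
open Literature.AlgebraicTopology.SingularHomology
open Literature.NumberTheory.Transcendental (complexDeRhamCohomology hodgePQ cclosedSmoothForms
  ComplexDeRhamIsoFamily DeRhamIsoFamily WedgeFacts integrationDeRhamIsoFamily
  integrationDeRhamIsoFamily_isNatural integrationDeRhamIsoFamily_isNormalized
  integrationDeRhamIsoFamily_isMultiplicative wedgeFacts_of_assoc cclosedOne coe_cclosedOne)
open Literature.Geometry.Kaehler (MForm deRhamCohomology SmoothHermitianBundle
  SmoothComplexVectorBundle)

namespace Literature.AlgebraicGeometry.HodgeTheory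

section HodgeTheory

variable {n : ℕ} {X : Motives.SchemeOver ℂ}

/-! ### Two unit lemmas: `[1_ℝ] ⊗ 1 = [1_ℂ]` on both sides of the comparison -/

/-- **`[1] ⊗ 1 = [1]` on de Rham classes**: the complexification `H⁰_dR(M; ℝ) → H⁰_dR(M; ℂ)` of
the real unit class `[1]` (`deRhamCohomology.one`, the class of the constant function `1`) is the
complex unit class `complexDeRhamCohomology.one` (the class of the constant function `(1 : ℂ)`):
both are the class of the same `0`-form. [cite: BottTu1982Forms, §I.1] -/
theorem complexDeRhamCohomology_ofReal_one (E : Type*) [NormedAddCommGroup E] [NormedSpace ℂ E]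
    (M : Type*) [TopologicalSpace M] [ChartedSpace E M] :
    complexDeRhamCohomology.ofReal E M 0 (deRhamCohomology.one 𝓘(ℝ, E) M ℝ) =
      complexDeRhamCohomology.one E M := by
  -- `(MForm.const _ _ (1 : ℝ)).ofReal` and `MForm.ofFun _ (fun _ ↦ (1 : ℂ))` agree definitionally
  rw [deRhamCohomology.one, complexDeRhamCohomology.ofReal_mk, complexDeRhamCohomology.one]
  congr 1

/-- **`1 ⊗ 1 = 1` on singular classes**: complexification `H⁰(Y; ℝ) → H⁰(Y; ℂ)` maps the unit
class to the unit class (both are the class of the cochain which is `1` on every `0`-simplex).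
Universe-polymorphic copy of `ofRealClass_one` (`HodgeRiemannDegreeOneProofs`, stated there for
`Y : Type` behind a heavy import cone). [cite: HatcherAT2002, §3.2 p. 211] -/
theorem ofRealClass_one' (Y : Type*) [TopologicalSpace Y] :
    ofRealClass Y 0 (singularCohomology.one ℝ Y) = singularCohomology.one ℂ Y := by
  rw [singularCohomology.one, ofRealClass_π, singularCohomology.one]
  congr 1
  refine singularCochainComplex.cocycles_ext ?_
  rw [coeffCocycle, AddMonoidHom.coe_mk, ZeroHom.coe_mk, singularCochainComplex.iCocycles_mk,
    singularCochainComplex.iCocycles_mk, singularCochainComplex.iCocycles_mk]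
  refine singularCochainComplex.ext fun σ ↦ ?_
  rw [coeffCochain_apply]
  simp

/-- **The complexification of a NORMALISED real de Rham family is unital**:
`(e ⊗ ℂ)[1] = 1 ∈ H⁰(M; ℂ)` (`re [1] = [1]`, `im [1] = 0`, `e[1] = 1`, `1 ⊗ 1 = 1`).
[cite: BottTu1982Forms, §I.5] -/
theorem complexifyFun_one {E : Type} [NormedAddCommGroup E] [NormedSpace ℂ E] {M : Type}
    [TopologicalSpace M] [ChartedSpace E M] [IsManifold 𝓘(ℝ, E) ∞ M] [T2Space M]
    [SigmaCompactSpace M] {e : DeRhamIsoFamily 𝓘(ℝ, E)} (he : e.IsNormalized) :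
    complexifyFun e 0 (complexDeRhamCohomology.one E M) = singularCohomology.one ℂ M := by
  rw [← complexDeRhamCohomology_ofReal_one, complexifyFun_ofReal, he M, ofRealClass_one']

namespace HodgeModel

/-! ### The definition -/

/-- **Chern-normalised Hodge models.** A Hodge model `A` of `X` is *Chern-normalised* when its
complex de Rham comparison family `A.deRham` (over all manifolds charted on `A.model`) IS de Rham's
isomorphism given by integration of forms over smooth singular simplices, complexified:
`A.deRham = (integrationDeRhamIsoFamily A.model) ⊗ ℂ`, `[α] ↦ (σ ↦ ∫_σ α)` (Voisin I, Thm. 4.47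
with Rem. 4.48; Warner 5.35–5.36; Bott–Tu Thm. 8.9 / 15.8; in the tree `[σ ↦ ∫_σ α]` is
`integrationDeRhamIsoFamily`, Bredon Thm. V.9.5 / Lee Thm. 18.14). This is THE comparison for which
the printed normalisation identities hold with no scalar — `[ω_{L,h}] = c₁(L)` (Voisin I Thm. 7.10),
`c₁(𝒪_X(1)) = [ω_FS|_X]` (Voisin I §7.2.3), `c_k(E) = [γ_k(Ω)]`, `ch(E) = [tr exp(−Ω/2πi)]` with
`∫_{ℙ¹} c₁(𝒪(−1)) = −1` (Kobayashi II Axiom 4, Thm. 2.16, (2.20)–(2.21)) — so that for such `A`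
equalities between Chern–Weil classes read through `A.deRham` and canonical Betti classes are
meaningful. Proved here: `A.deRham` is multiplicative (`….deRham_mk_wedge`, Warner Thm. 5.45), unital
(`….deRham_one`, whence `ch₀ = rank`, `….chernCharacter_zero`) and real (`….isReal`, Voisin I
Cor. 6.12); degree-`2` normalisation (Lefschetz `(1,1)` in Chern–Weil form, no scalar: Voisin I
Thm. 11.30 with Thm. 7.10 (i)) in `HodgeModelChernNormalisedHolds`; every `X` with a Hodge model has
a Chern-normalised one (`chernNormalise`, `exists_isChernNormalised_of_nonempty`).
[cite: VoisinHodgeI2002, §4.3.2 Thm. 4.47, Rem. 4.48 and Thm. 7.10]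
[cite: Kobayashi1987, Ch. II §1 Axiom 4 and §2 Thm. 2.16, (2.20)–(2.21)]
[cite: WarnerGTM94, 5.35–5.36 and Thm. 5.45] -/
def IsChernNormalised (A : HodgeModel n X) : Prop :=
  A.deRham = (integrationDeRhamIsoFamily A.model).complexify

/-- Unfolding: `A` is Chern-normalised iff on every manifold `M` charted on `A.model`, in every
degree, `A.deRham_M = (integration ⊗ ℂ)_M`, i.e. `A.deRham_M c = e(re c) ⊗ 1 + i • e(im c) ⊗ 1`
with `e = integrationDeRhamIsoFamily A.model` (`complexifyFun`). [cite: VoisinHodgeI2002, §4.3.2 Rem. 4.48 and §6.1.3 Cor. 6.12] -/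
theorem isChernNormalised_iff (A : HodgeModel n X) :
    A.IsChernNormalised ↔ ∀ (M : Type) [TopologicalSpace M] [ChartedSpace A.model M]
      [IsManifold 𝓘(ℝ, A.model) ∞ M] [T2Space M] [SigmaCompactSpace M] (k : ℕ)
      (c : complexDeRhamCohomology A.model M k),
      A.deRham M k c = complexifyFun (integrationDeRhamIsoFamily A.model) k c := by
  constructor
  · intro h M _ _ _ _ _ k c
    rw [h, complexify_apply]
  · intro h
    funext M _ _ _ _ _ k
    exact LinearEquiv.ext (h M k)

variable (A : HodgeModel n X)

/-! ### The normalisation of a Hodge model, and existence -/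

/-- **The Chern normalisation of a Hodge model**: the same analytification `A.carrier → X(ℂ)` and
the same Hodge decomposition, with the comparison family replaced by de Rham's integration
isomorphism `(integrationDeRhamIsoFamily A.model) ⊗ ℂ` (natural:
`integrationDeRhamIsoFamily_isNatural`, `DeRhamIsoFamily.complexify_isNatural`; the field
`isInternal_hodgePQ` is a statement about de Rham cohomology and does not see the comparison).
[cite: VoisinHodgeI2002, §4.3.2 Thm. 4.47 and Rem. 4.48] [cite: LeeSmoothManifolds2013, Thm. 18.14] -/
def chernNormalise : HodgeModel n X :=
  { A with
    deRham := (integrationDeRhamIsoFamily A.model).complexify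
    deRham_isNatural := DeRhamIsoFamily.complexify_isNatural integrationDeRhamIsoFamily_isNatural }

/-- The normalisation keeps the model space (definitional). [folklore] -/
@[simp]
theorem chernNormalise_model : A.chernNormalise.model = A.model :=
  rfl

/-- The normalisation keeps the carrier `X^an` (definitional). [folklore] -/
@[simp]
theorem chernNormalise_carrier : A.chernNormalise.carrier = A.carrier :=
  rfl

/-- The comparison family of the normalisation is de Rham's integration isomorphism, complexified
(definitional). [cite: VoisinHodgeI2002, §4.3.2 Rem. 4.48] -/
@[simp]
theorem chernNormalise_deRham :
    A.chernNormalise.deRham = (integrationDeRhamIsoFamily A.model).complexify :=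
  rfl

/-- The normalisation keeps the pull-back `Hᵏ(X(ℂ); ℂ) → Hᵏ(X^an; ℂ)` (definitional). [folklore] -/
@[simp]
theorem chernNormalise_pullback (k : ℕ) : A.chernNormalise.pullback k = A.pullback k :=
  rfl

/-- The `H^{p,q}` of the normalisation is the image of the de Rham `H^{p,q}` under the integration
comparison (definitional). [cite: VoisinHodgeI2002, §6.1.3] -/
theorem chernNormalise_hodgePQ (k p q : ℕ) :
    A.chernNormalise.hodgePQ k p q =
      (Literature.NumberTheory.Transcendental.hodgePQ A.model A.carrier k p q).map
        ((integrationDeRhamIsoFamily A.model).complexify A.carrier k).toLinearMap :=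
  rfl

/-- **The normalisation is Chern-normalised** (definitional). [cite: VoisinHodgeI2002, §4.3.2 Rem. 4.48] -/
theorem isChernNormalised_chernNormalise : A.chernNormalise.IsChernNormalised :=
  rfl

variable {A}

/-- A Chern-normalised model is its own normalisation. [folklore] -/
theorem IsChernNormalised.chernNormalise_eq (hA : A.IsChernNormalised) : A.chernNormalise = A := by
  rcases A with ⟨E, M, φ, hφ, e, he, hH⟩
  change e = (integrationDeRhamIsoFamily E).complexify at hA
  subst hA
  rfl

/-- **Every `X` with a Hodge model has a Chern-normalised Hodge model** (normalise any model).
[cite: VoisinHodgeI2002, §4.3.2 Thm. 4.47 and Rem. 4.48] -/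
theorem exists_isChernNormalised_of_nonempty (h : Nonempty (HodgeModel n X)) :
    ∃ A : HodgeModel n X, A.IsChernNormalised :=
  let ⟨A⟩ := h
  ⟨A.chernNormalise, A.isChernNormalised_chernNormalise⟩

variable (n X) in
/-- **Smooth projective complex varieties have Chern-normalised Hodge models**, granted the named
fact `nonempty_hodgeModel n X` (Serre GAGA §2, de Rham, Hodge decomposition — discharged as
`nonempty_hodgeModel_holds`; fully discharged form `exists_isChernNormalised_holds`,
`HodgeModelChernNormalisedHolds`) — the companion existence statement. [cite: SerreGAGA1956, §2]
[cite: VoisinHodgeI2002, §4.3.2 Rem. 4.48 and §6.1.3] -/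
theorem exists_isChernNormalised (h : nonempty_hodgeModel n X) (hX : Motives.IsSmoothProjective n X) :
    ∃ A : HodgeModel n X, A.IsChernNormalised :=
  exists_isChernNormalised_of_nonempty (h hX)

/-! ### The comparison of a Chern-normalised model, unfolded -/

/-- For a Chern-normalised model, `A.deRham_M c = e(re c) ⊗ 1 + i • e(im c) ⊗ 1` with `e` the
integration family, on every manifold `M` charted on `A.model`. [cite: VoisinHodgeI2002, §4.3.2 Rem. 4.48 and §6.1.3 Cor. 6.12] -/
theorem IsChernNormalised.deRham_apply (hA : A.IsChernNormalised) (M : Type) [TopologicalSpace M]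
    [ChartedSpace A.model M] [IsManifold 𝓘(ℝ, A.model) ∞ M] [T2Space M] [SigmaCompactSpace M]
    (k : ℕ) (c : complexDeRhamCohomology A.model M k) :
    A.deRham M k c = complexifyFun (integrationDeRhamIsoFamily A.model) k c := by
  rw [hA, complexify_apply]

/-- On a real class `a ⊗ 1`, a Chern-normalised comparison is the real integration isomorphism:
`A.deRham (a ⊗ 1) = (∫ a) ⊗ 1`. [cite: VoisinHodgeI2002, §6.1.3 Cor. 6.12] -/
theorem IsChernNormalised.deRham_ofReal (hA : A.IsChernNormalised) (M : Type) [TopologicalSpace M]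
    [ChartedSpace A.model M] [IsManifold 𝓘(ℝ, A.model) ∞ M] [T2Space M] [SigmaCompactSpace M]
    (k : ℕ) (a : deRhamCohomology 𝓘(ℝ, A.model) M ℝ k) :
    A.deRham M k (complexDeRhamCohomology.ofReal A.model M k a) =
      ofRealClass M k (integrationDeRhamIsoFamily A.model M k a) := by
  rw [hA.deRham_apply, complexifyFun_ofReal]

/-- `H^{p,q}` of a Chern-normalised model is the image of the de Rham `H^{p,q}` under the
integration comparison. [cite: VoisinHodgeI2002, §6.1.3] -/
theorem IsChernNormalised.hodgePQ_eq (hA : A.IsChernNormalised) (k p q : ℕ) :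
    A.hodgePQ k p q =
      (Literature.NumberTheory.Transcendental.hodgePQ A.model A.carrier k p q).map
        ((integrationDeRhamIsoFamily A.model).complexifyEquiv A.carrier k).toLinearMap := by
  rw [← hA.chernNormalise_eq]
  rfl

/-! ### (a) Multiplicativity: `A.deRham[α ∧ β] = A.deRham[α] ⌣ A.deRham[β]` -/

/-- The wedge calculus of complex forms holds on every manifold charted on `A.model` (the tree's
`wedgeFacts_of_assoc` + `ContinuousAlternatingMap.WedgeAssoc_holds`); feeds the instance hypothesis
`[WedgeFacts 𝓘(ℝ, A.model) M ℂ]` below with `haveI`. [cite: WarnerGTM94, 2.4 / 2.10(b)] -/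
theorem wedgeFacts (A : HodgeModel n X) (M : Type*) [TopologicalSpace M] [ChartedSpace A.model M] :
    WedgeFacts 𝓘(ℝ, A.model) M ℂ :=
  wedgeFacts_of_assoc 𝓘(ℝ, A.model) M ℂ (ContinuousAlternatingMap.WedgeAssoc_holds ℝ A.model ℂ)

/-- **A Chern-normalised comparison is multiplicative**: for closed smooth complex forms `α`, `β`
on any manifold `M` charted on `A.model`, `A.deRham[α ∧ β] = A.deRham[α] ⌣ A.deRham[β]`
— the integration family is multiplicative (`integrationDeRhamIsoFamily_isMultiplicative`, Warner
Thm. 5.45) and complexification preserves this (`complexifyFun_mk_wedge`); this is the hypothesis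
shape `hmul` of `HodgeModel.pullback_cupProduct_mem_hodgePQ_of_mul` (`ComplexGysinHodgeTypeModels`).
[cite: WarnerGTM94, Thm. 5.45] [cite: VoisinHodgeI2002, §5.3.2 Thm. 5.29] -/
theorem IsChernNormalised.deRham_mk_wedge (hA : A.IsChernNormalised) (M : Type) [TopologicalSpace M]
    [ChartedSpace A.model M] [IsManifold 𝓘(ℝ, A.model) ∞ M] [T2Space M] [SigmaCompactSpace M]
    [WedgeFacts 𝓘(ℝ, A.model) M ℂ] (k l : ℕ) (α : cclosedSmoothForms A.model M k)
    (β : cclosedSmoothForms A.model M l) :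
    A.deRham M (k + l) (complexDeRhamCohomology.mk A.model M (k + l)
        ⟨(α : MForm 𝓘(ℝ, A.model) M ℂ k).wedge (β : MForm 𝓘(ℝ, A.model) M ℂ l),
          wedge_mem_cclosedSmoothForms α.2 β.2⟩) =
      cupProduct rfl (A.deRham M k (complexDeRhamCohomology.mk A.model M k α))
        (A.deRham M l (complexDeRhamCohomology.mk A.model M l β)) := by
  haveI : WedgeFacts 𝓘(ℝ, A.model) M ℝ :=
    wedgeFacts_of_assoc 𝓘(ℝ, A.model) M ℝ (ContinuousAlternatingMap.WedgeAssoc_holds ℝ A.model ℝ)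
  rw [hA.deRham_apply, hA.deRham_apply, hA.deRham_apply]
  exact complexifyFun_mk_wedge integrationDeRhamIsoFamily_isMultiplicative α β

/-- **In a Chern-normalised model cup products ADD Hodge types**: if `a ∈ H^{p,q}` and
`b ∈ H^{p',q'}` in `H˙(X^an; ℂ)` (types read in `A`), then `a ⌣ b ∈ H^{p+p',q+q'}` (read in the
SAME model `A`): cup = wedge on representatives (Thm. 5.29) and types add under `∧` (§7.1.2);
`cupProduct_mem_map_hodgePQ` for the integration family. [cite: VoisinHodgeI2002, §5.3.2 Thm. 5.29 and §7.1.2] -/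
theorem IsChernNormalised.cupProduct_mem_hodgePQ (hA : A.IsChernNormalised) {k l s : ℕ}
    (h : k + l = s) {p q p' q' : ℕ} {a : singularCohomology ℂ ℂ A.carrier k}
    {b : singularCohomology ℂ ℂ A.carrier l} (ha : a ∈ A.hodgePQ k p q)
    (hb : b ∈ A.hodgePQ l p' q') : cupProduct h a b ∈ A.hodgePQ s (p + p') (q + q') := by
  subst h
  haveI : WedgeFacts 𝓘(ℝ, A.model) A.carrier ℂ := A.wedgeFacts A.carrier
  haveI : WedgeFacts 𝓘(ℝ, A.model) A.carrier ℝ :=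
    wedgeFacts_of_assoc 𝓘(ℝ, A.model) A.carrier ℝ
      (ContinuousAlternatingMap.WedgeAssoc_holds ℝ A.model ℝ)
  rw [hA.hodgePQ_eq] at ha hb ⊢
  obtain ⟨u, hu, rfl⟩ := Submodule.mem_map.1 ha
  obtain ⟨v, hv, rfl⟩ := Submodule.mem_map.1 hb
  exact cupProduct_mem_map_hodgePQ integrationDeRhamIsoFamily_isMultiplicative hu hv

/-- **Model form of `CupPreservesHodgeType` for Chern-normalised models**: for
`a ∈ Hᵏ(X(ℂ); ℂ)`, `b ∈ Hˡ(X(ℂ); ℂ)` with `A^* a ∈ H^{p,q}` and `A^* b ∈ H^{p',q'}`,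
`A^*(a ⌣ b) ∈ H^{p+p',q+q'}` — all types read in `A` (`A^*` is multiplicative, Hatcher Prop. 3.10).
[cite: VoisinHodgeI2002, §5.3.2 Thm. 5.29 and §7.1.2] [cite: HatcherAT2002, Prop. 3.10] -/
theorem IsChernNormalised.pullback_cupProduct_mem_hodgePQ (hA : A.IsChernNormalised) {k l s : ℕ}
    (h : k + l = s) {p q p' q' : ℕ}
    {a : singularCohomology ℂ ℂ (Motives.ComplexPoints X) k}
    {b : singularCohomology ℂ ℂ (Motives.ComplexPoints X) l}
    (ha : A.pullback k a ∈ A.hodgePQ k p q) (hb : A.pullback l b ∈ A.hodgePQ l p' q') :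
    A.pullback s (cupProduct h a b) ∈ A.hodgePQ s (p + p') (q + q') := by
  have hcup : A.pullback s (cupProduct h a b) = cupProduct h (A.pullback k a) (A.pullback l b) :=
    cupProduct_map _ h a b
  rw [hcup]
  exact hA.cupProduct_mem_hodgePQ h ha hb

/-! ### (a') Unitality: `A.deRham[1] = 1`, hence `ch₀ = rank` -/

/-- **A Chern-normalised comparison is unital**: on every manifold `M` charted on `A.model` it sends
the unit class `[1] ∈ H⁰_dR(M; ℂ)` to the unit `1 ∈ H⁰(M; ℂ)` (the integration family is
normalised, `integrationDeRhamIsoFamily_isNormalized`: `∫_σ 1 = 1` on `0`-simplices).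
[cite: LeeSmoothManifolds2013, Thm. 18.14] [cite: BottTu1982Forms, §I.5] -/
theorem IsChernNormalised.deRham_one (hA : A.IsChernNormalised) (M : Type) [TopologicalSpace M]
    [ChartedSpace A.model M] [IsManifold 𝓘(ℝ, A.model) ∞ M] [T2Space M] [SigmaCompactSpace M] :
    A.deRham M 0 (complexDeRhamCohomology.one A.model M) = singularCohomology.one ℂ M := by
  rw [hA.deRham_apply, complexifyFun_one integrationDeRhamIsoFamily_isNormalized]

/-- **`ch₀(F) = rank F` for Chern-normalised models**: the degree-`0` Chern character of a `C^∞`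
Hermitian vector bundle `F` on a manifold charted on `A.model`, read through `A.deRham`, is
`rank F · 1 ∈ H⁰(M; ℂ)` (Kobayashi II (1.10), `ch(E) = r + c₁(E) + ⋯`; for a general model only
`rank F · A.deRham[1]`, `SmoothHermitianBundle.chernCharacter_zero`). [cite: Kobayashi1987, Ch. II §1 (1.10)] -/
theorem IsChernNormalised.chernCharacter_zero (hA : A.IsChernNormalised) {M : Type}
    [TopologicalSpace M] [ChartedSpace A.model M] [IsManifold 𝓘(ℝ, A.model) ∞ M] [T2Space M]
    [SigmaCompactSpace M] (F : SmoothHermitianBundle A.model M) :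
    F.chernCharacter A.deRham 0 = (F.rank : ℂ) • singularCohomology.one ℂ M := by
  rw [SmoothHermitianBundle.chernCharacter_zero, hA.deRham_one]

/-! ### (b) Reality -/

/-- **A Chern-normalised comparison family is real**: it intertwines conjugation of forms and
conjugation of cochain values, on every manifold charted on `A.model` (the complexification of
every real family is real, `DeRhamIsoFamily.complexify_isReal`). [cite: VoisinHodgeI2002, §6.1.3 Cor. 6.12] -/
theorem IsChernNormalised.deRham_isReal (hA : A.IsChernNormalised) : A.deRham.IsReal := by
  rw [hA]
  exact DeRhamIsoFamily.complexify_isReal _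

/-- **A Chern-normalised Hodge model is real** (`HodgeModel.IsReal`). [cite: VoisinHodgeI2002, §6.1.3 Cor. 6.12] -/
theorem IsChernNormalised.isReal (hA : A.IsChernNormalised) : A.IsReal :=
  fun k c ↦ hA.deRham_isReal A.carrier k c

/-- … hence Hodge symmetric: `conj H^{p,q} = H^{q,p}` in `A`. [cite: VoisinHodgeI2002, §6.1.3 Cor. 6.12] -/
theorem IsChernNormalised.isHodgeSymmetric (hA : A.IsChernNormalised) : A.IsHodgeSymmetric :=
  hA.isReal.isHodgeSymmetric

end HodgeModel

end HodgeTheory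

end Literature.AlgebraicGeometry.HodgeTheory
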